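import Summits.Schanuel.Schanuel.Theses.RoyCriterion
import Literature.NumberTheory.Transcendental.RoyCriterionProp3Proofs

/-!
# Schanuel / RoyCriterion — `RoyEquivalence` (item `stmt-Schanuel-10561`): Roy's equivalence, rank by rank

Route `Schanuel/RoyCriterion`, support item `stmt-Schanuel-10561` (route declaration
`Summit.Schanuel.Schanuel.Theses.RoyCriterion.RoyEquivalence`, which unfolds to the named fact
`Literature.NumberTheory.Transcendental.Roy2001_iff = ∀ l, RoyCriterion l ↔ SchanuelRank l`):
Roy's theorem that his arithmetic criterion (Conjecture 2 of Roy, *An arithmetic criterion for the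
values of the exponential function*, Acta Arith. 97 (2001), §1) in rank `l` is equivalent to
Schanuel's conjecture in rank `l` (Roy 2001, §1 + Thm 1 + §5, pp. 183–184, 193–194).

The equivalence is PROVED in tree, sorry-free, as
`Literature.NumberTheory.Transcendental.Roy2001_iff_holds`
(`Literature/NumberTheory/Transcendental/RoyCriterionProp3Proofs.lean`): direction `2°`
(`RoyCriterion l → SchanuelRank l`) by Waldschmidt's auxiliary polynomial (`exists_royAuxPoly`) and
Cauchy's inequalities, direction `1°` (`SchanuelRank l → RoyCriterion l`) by Roy's Theorem 1
`(b) ⇒ (a)`, i.e. Proposition 3 (`Roy2001_prop3_holds`). This file only restates that theorem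
against the route declaration BY NAME so that the gate can close the item; the route carries the
equivalence as an item (not an import of the proof module into the Theses file) so that the deciding
theorem `closes (hA : Assembly) (hE : RoyEquivalence) (hX : RoyThesisTyped) : Schanuel` depends on
`RoyCriterion.lean` alone.

Not here: the assembly items (`Theorems/RoyCriterionAssembly*.lean`) and the rank-one case
(`Theorems/RoyCriterionRoyCriterionRankOne.lean`), closed separately.
-/

-- single-conjunct summit: `Summit.Schanuel.Schanuel.…` is the mandated namespace (CONVENTIONS §1–2,
-- D-0017); without this option `linter.dupNamespace` warns on every declaration below.
set_option linter.dupNamespace false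

namespace Summit.Schanuel.Schanuel.Theorems.RoyCriterion

/-- Settles `stmt-Schanuel-10561`: the route declaration
`Summit.Schanuel.Schanuel.Theses.RoyCriterion.RoyEquivalence` (= `Roy2001_iff`, i.e.
`∀ l, RoyCriterion l ↔ SchanuelRank l` — Roy's Conjecture 2 in rank `l` is equivalent to Schanuel's
conjecture in rank `l`) holds, unconditionally, by the tree theorem
`Literature.NumberTheory.Transcendental.Roy2001_iff_holds`. [cite: Roy2001, Thm. 1 and §5] -/
theorem RoyEquivalence_proof :
    Summit.Schanuel.Schanuel.Theses.RoyCriterion.RoyEquivalence := by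
  unfold Summit.Schanuel.Schanuel.Theses.RoyCriterion.RoyEquivalence
  exact Literature.NumberTheory.Transcendental.Roy2001_iff_holds

end Summit.Schanuel.Schanuel.Theorems.RoyCriterion
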